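import Mathlib
import HarnessLib

/-!
# Route `ModularQuarterTurn`: toroidal vocabulary of the disc modular flow
(`<Route>Defs` file, D-0016; first user: item stmt-CriticalPhenomena-6497 `ToroidalInversionUpgrade`)

Route-posited objects of the crux `BallModularMoebius` / support item `ToroidalInversionUpgrade`,
as plain real functions (nothing is asserted here):

* `Jf r c a b` — the conformal factor `J = 2 / ((1 + t²) + (1 - t²) c)` of the route
  (`t² = (a² + b²)/r²`, `c = cos ψ`), verbatim the route's inline expression;
* `Mf r c s a b : ℝ³` — the image `M_ψ(a, b) = (J a, J b, -(r/2)(1 - t²) sin ψ · J)` of the disc point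
  `(a, b, 0)` under the elliptic Möbius rotation by `ψ` about the rim circle `{x₂ = 0, |x| = r}`
  (`c = cos ψ`, `s = sin ψ`), verbatim the route's inline expression;
* the closed-form INVERSE chart (toroidal / bispherical coordinates about the rim circle) of a point
  `y` off the `x₂`-axis: `rho y = √(y₀² + y₁²)`, `nsq y = ‖y‖²` in coordinates,
  `disc r y = (‖y‖² - r²)² + 4 r² y₂²` (vanishing exactly on the rim circle),
  `tf r y ∈ (0,1)` (the smaller root of `t + 1/t = (‖y‖² + r²)/(r ρ)`), the disc point
  `(af r y, bf r y) = (r t/ρ)(y₀, y₁)`, and `(cf r y, sf r y) = (cos ψ, sin ψ)`,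
  `angf r y = ψ ∈ (-π, π]` (via `Complex.arg`).

The identities `M_ψ(af, bf) = y`, `M_{ψ+π}(af, bf) = (r²/‖y‖²) θ₂ y`, `J(ψ+π) = J(ψ) r²/‖y‖²` and the
injectivity of the chart are proved in `Theorems/ModularQuarterTurnToroidalInversionUpgradeGeometry.lean`.
References: elementary Möbius geometry of `ℝ³ ∪ {∞}` (Di Francesco–Mathieu–Sénéchal 1997 §4.1); the
elliptic one-parameter group fixing a circle is the Euclidean section of the Hislop–Longo modular flow
of a double cone (Comm. Math. Phys. 84 (1982), §2).
-/

noncomputable section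

namespace Summit.CriticalPhenomena.Ising3DConformalLimit.ModularQuarterTurnToroidal

/-- The conformal factor `J` of the route `ModularQuarterTurn` (crux `BallModularMoebius`), as a function
of `c = cos ψ` and the disc point `(a, b)`: `J = 2 / ((1 + t²) + (1 - t²) c)`, `t² = (a² + b²)/r²`.
[folklore] -/
def Jf (r c a b : ℝ) : ℝ :=
  2 / ((1 + ((a ^ 2 + b ^ 2) / r ^ 2)) + (1 - ((a ^ 2 + b ^ 2) / r ^ 2)) * c)

/-- The toroidal image point `M_ψ(a, b) = (J a, J b, -(r/2)(1-t²) sin ψ · J)` of the route, as a function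
of `c = cos ψ`, `s = sin ψ` and the disc point `(a, b)`. [folklore] -/
def Mf (r c s a b : ℝ) : EuclideanSpace ℝ (Fin 3) :=
  !₂[Jf r c a b * a, Jf r c a b * b, -(r / 2) * (1 - ((a ^ 2 + b ^ 2) / r ^ 2)) * s * Jf r c a b]

/-- Distance from the `x₂`-axis. [folklore] -/
def rho (y : EuclideanSpace ℝ (Fin 3)) : ℝ := Real.sqrt (y 0 ^ 2 + y 1 ^ 2)

/-- Squared norm `‖y‖²` in coordinates. [folklore] -/
def nsq (y : EuclideanSpace ℝ (Fin 3)) : ℝ := y 0 ^ 2 + y 1 ^ 2 + y 2 ^ 2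

/-- The discriminant `(‖y‖² - r²)² + 4 r² y₂²`; it vanishes exactly on the rim circle. [folklore] -/
def disc (r : ℝ) (y : EuclideanSpace ℝ (Fin 3)) : ℝ := (nsq y - r ^ 2) ^ 2 + 4 * r ^ 2 * y 2 ^ 2

/-- The toroidal radius parameter `t ∈ (0,1)` of `y`: the smaller root of `t + 1/t = (‖y‖² + r²)/(r ρ)`.
[folklore] -/
def tf (r : ℝ) (y : EuclideanSpace ℝ (Fin 3)) : ℝ :=
  (nsq y + r ^ 2 - Real.sqrt (disc r y)) / (2 * r * rho y)

/-- First coordinate of the disc point of `y`. [folklore] -/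
def af (r : ℝ) (y : EuclideanSpace ℝ (Fin 3)) : ℝ := r * tf r y * y 0 / rho y

/-- Second coordinate of the disc point of `y`. [folklore] -/
def bf (r : ℝ) (y : EuclideanSpace ℝ (Fin 3)) : ℝ := r * tf r y * y 1 / rho y

/-- Cosine of the toroidal angle of `y`. [folklore] -/
def cf (r : ℝ) (y : EuclideanSpace ℝ (Fin 3)) : ℝ := (r ^ 2 - nsq y) / Real.sqrt (disc r y)

/-- Sine of the toroidal angle of `y`. [folklore] -/
def sf (r : ℝ) (y : EuclideanSpace ℝ (Fin 3)) : ℝ := -(2 * r * y 2) / Real.sqrt (disc r y)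

/-- The toroidal angle of `y`, in `(-π, π]`. [folklore] -/
def angf (r : ℝ) (y : EuclideanSpace ℝ (Fin 3)) : ℝ := Complex.arg ⟨cf r y, sf r y⟩

/-- `‖y‖² = y₀² + y₁² + y₂²`. [folklore] -/
theorem nsq_eq_norm_sq (y : EuclideanSpace ℝ (Fin 3)) : nsq y = ‖y‖ ^ 2 := by
  rw [EuclideanSpace.real_norm_sq_eq, Fin.sum_univ_three, nsq]

end Summit.CriticalPhenomena.Ising3DConformalLimit.ModularQuarterTurnToroidal

end
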